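import Summits.CriticalPhenomena.PercolationContinuityZ3.Theorems.Transplant.ProdCylinderStrict
import Summits.CriticalPhenomena.PercolationContinuityZ3.Theorems.Transplant.CayleySkeletonConn
import Summits.CriticalPhenomena.PercolationContinuityZ3.Theorems.Transplant.PlanarSkeletonConcBoxProd
import Summits.CriticalPhenomena.PercolationContinuityZ3.Theorems.Transplant.StatementBoxProdZ2
import HarnessLib

/-!
# `θ(p_c) = 0` on `X □ Cay(Γ;S)` for EVERY quasi-transitive `X` (Cayley or not) and every `CayleySign₂` datum on `(Γ, S)`

builds on p205010 (kernel theorem, internal audit signed; external expert review pending).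
Lane `prim-bschramm`, seat `prim-bschramm-p4` gen 11 (PART C3 of `P4-GENERAL.md`, residual (ii) of §32: `X □ Cay` for NON-Cayley `X`).
Helper file (`--supports stmt-CriticalPhenomena-4575 --as helper`).

`X` connected, locally finite, with a degree bound and a quasi-transitivity witness (`V₀` finite, every vertex moved into `V₀` by an
automorphism) — e.g. every vertex-transitive graph, Cayley or not (finite ones such as the Petersen graph included); `(Γ, S)` with a
`CayleySign₂` (additive planar skeleton of unit range, two sign automorphisms, `C_1` connected).  Then `X □ Cay(Γ;S)` carries the
`PlanarSkeletonSign` `(u, g) ↦ φ g` (`prodSkeleton`: frames `γ × (left translation)`, point group `id × ν`, `id × κ`, cylinders `X × C_ℓ`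
connected), its cylinders are subcritical at `p_c` by the PRODUCT strict inequality of file XIII (`prod_cylSubcritical`), so the closed D″ node
gives **`CayleySign₂.theta_boxProd_eq_zero_of_le`: `θ_v(p) = 0` for every `p ≤ p_c` at every vertex of `X □ Cay(Γ;S)`** — unconditionally;
gen 10's `CayleySign₁.criticalContinuity_boxProd` needed `X` to be a Cayley graph.
[cite: BenjaminiSchramm1996, Conj. 4; §2 (products, quasi-transitive graphs)] [cite: KozmaNitzan2024, §1 p. 2 (approach 1)]
-/

noncomputable section

namespace Summit.CriticalPhenomena.PercolationContinuityZ3.Theorems.Transplant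

open SimpleGraph Walk Literature.Probability.LatticeModels Literature.Probability.Percolation
open Literature.Barriers.CriticalPhenomena (countable_of_connected_of_locallyFinite)
open scoped Classical

namespace CayleySign₂

variable {Γ : Type} [Group Γ] {S : Finset Γ} (D : CayleySign₂ Γ S)
variable {W : Type} (X : SimpleGraph W) [X.LocallyFinite]

/-! ## §1 The product skeleton -/

/-- **THE PLANAR SIGN SKELETON OF `X □ Cay(Γ;S)`**: height through the Cayley factor, base set `V₀ × {1}`, frames `γ × L_g`, point group
`id × ν`, `id × κ`. [cite: KozmaNitzan2024, §4 p. 16 (Lemma 8)] [cite: BenjaminiSchramm1996, §2 (products)] -/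
def prodSkeleton (hc : X.Connected) {ΔX : ℕ} (hΔ : ∀ u, X.degree u ≤ ΔX) (V₀ : Finset W) (hV₀ : ∀ v : W, ∃ γ : X ≃g X, γ v ∈ V₀) :
    PlanarSkeletonSign (X □ mulCayley (S : Set Γ)) where
  φ := fun w => D.φ w.2
  lip := fun a b h i => by
    rcases boxProd_adj.1 h with ⟨-, h2⟩ | ⟨h1, -⟩
    · rw [h2, sub_self, abs_zero]; exact zero_le_one
    · rw [abs_sub_comm]; exact D.base.lip_adj h1 i
  types := V₀ ×ˢ {1}
  frame := fun v => by
    obtain ⟨γ, hγ⟩ := hV₀ v.1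
    refine ⟨(γ v.1, 1), Finset.mk_mem_product hγ (Finset.mem_singleton_self _), boxProdIso γ.symm (leftMulIso S v.2), ?_, fun w => ?_⟩
    · rw [boxProdIso_apply, leftMulIso_apply, mul_one, RelIso.symm_apply_apply]
    · rw [boxProdIso_apply, leftMulIso_apply]
      show D.φ (v.2 * w.2) = D.φ w.2 + (D.φ v.2 - D.φ 1)
      rw [D.map_mul, D.toCayleyNeg₂.φ_one, sub_zero, add_comm]
  neg := fun t ht => by
    obtain ⟨-, ht2⟩ := Finset.mem_product.1 ht
    rw [Finset.mem_singleton] at ht2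
    refine ⟨boxProdIso (RelIso.refl _) (autOfMulEquiv S D.ν D.ν_mem), ?_, fun w => ?_⟩
    · rw [boxProdIso_apply, autOfMulEquiv_apply, ht2, map_one]; exact Prod.ext rfl ht2.symm
    · rw [boxProdIso_apply, autOfMulEquiv_apply]
      show D.φ (D.ν w.2) - D.φ t.2 = -(D.φ w.2 - D.φ t.2)
      rw [ht2, D.toCayleyNeg₂.φ_one, sub_zero, sub_zero, D.ν_φ]
  Δ := ΔX + 2 * S.card
  degree_le := fun v => by
    rw [degree_boxProd]
    exact add_le_add (hΔ v.1) (degree_mulCayley_le S v.2)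
  step := fun v i σ => by
    obtain ⟨s, hs, hφ⟩ := D.step i
    have hs1 : s ≠ 1 := by
      intro h
      have h0 := congrFun hφ i
      rw [h, D.toCayleyNeg₂.φ_one] at h0
      simp at h0
    rcases Int.units_eq_one_or σ with rfl | rfl
    · refine ⟨(v.1, v.2 * s), boxProd_adj_right.2 (CayCyl.adj_mul_of_mem S (Or.inl hs) hs1 v.2), ?_⟩
      show D.φ (v.2 * s) = D.φ v.2 + Pi.single i ((1 : ℤˣ) : ℤ)
      rw [D.map_mul, hφ, Units.val_one]
    · refine ⟨(v.1, v.2 * s⁻¹), boxProd_adj_right.2 (CayCyl.adj_mul_of_mem S (Or.inr (by rw [inv_inv]; exact hs)) (inv_ne_one.2 hs1) v.2), ?_⟩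
      show D.φ (v.2 * s⁻¹) = D.φ v.2 + Pi.single i ((-1 : ℤˣ) : ℤ)
      rw [D.map_mul, show D.φ s⁻¹ = -D.φ s from D.base.φ_inv s, hφ, Units.val_neg, Units.val_one, Pi.single_neg]
  flip := fun t ht => by
    obtain ⟨-, ht2⟩ := Finset.mem_product.1 ht
    rw [Finset.mem_singleton] at ht2
    refine ⟨boxProdIso (RelIso.refl _) (autOfMulEquiv S D.κ D.κ_mem), ?_, fun w => ?_⟩
    · rw [boxProdIso_apply, autOfMulEquiv_apply, ht2, map_one]; exact Prod.ext rfl ht2.symm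
    · rw [boxProdIso_apply, autOfMulEquiv_apply]
      show D.φ (D.κ w.2) - D.φ t.2 = flipSnd (D.φ w.2 - D.φ t.2)
      rw [ht2, D.toCayleyNeg₂.φ_one, sub_zero, sub_zero, D.κ_φ]
  cyl_connected := fun t ht ℓ hℓ => by
    obtain ⟨-, ht2⟩ := Finset.mem_product.1 ht
    rw [Finset.mem_singleton] at ht2
    have e : {w : W × Γ | D.φ w.2 - D.φ t.2 ∈ box 2 ℓ} = (Set.univ : Set W) ×ˢ D.cylData₂.enl.V ℓ := by
      ext w
      simp only [Set.mem_setOf_eq, Set.mem_prod, Set.mem_univ, true_and, CayCyl.CylData.V, ht2, D.toCayleyNeg₂.φ_one, sub_zero]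
      rfl
    show ((X □ mulCayley (S : Set Γ)).induce {w : W × Γ | D.φ w.2 - D.φ t.2 ∈ box 2 ℓ}).Connected
    rw [e]
    exact induce_univ_prod_connected X _ hc (D.toCayleyNeg₂.cylG_connected hℓ)

/-! ## §2 The cylinders of the product are subcritical at `p_c` -/

/-- The cylinder of the product skeleton at `(u₀, 1)` is `X × C_ℓ`, as graphs. [folklore] -/
def cylIso (ℓ : ℕ) : (X □ mulCayley (S : Set Γ)).induce {w : W × Γ | D.φ w.2 - D.φ (1 : Γ) ∈ box 2 ℓ} ≃g D.cylData₂.pcylG X ℓ where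
  toFun := fun w => (w.1.1, ⟨w.1.2, by
    have h := w.2
    simp only [Set.mem_setOf_eq, D.toCayleyNeg₂.φ_one, sub_zero] at h
    exact h⟩)
  invFun := fun v => ⟨(v.1, v.2.1), by
    have h := v.2.2
    simp only [Set.mem_setOf_eq, D.toCayleyNeg₂.φ_one, sub_zero]
    exact h⟩
  left_inv := fun _ => rfl
  right_inv := fun _ => rfl
  map_rel_iff' := by
    intro a b
    simp only [Equiv.coe_fn_mk, boxProd_adj, comap_adj, Function.Embedding.subtype_apply]
    constructor
    · rintro (⟨h1, h2⟩ | ⟨h1, h2⟩)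
      · exact Or.inl ⟨h1, congrArg Subtype.val h2⟩
      · exact Or.inr ⟨h1, h2⟩
    · rintro (⟨h1, h2⟩ | ⟨h1, h2⟩)
      · exact Or.inl ⟨h1, Subtype.ext h2⟩
      · exact Or.inr ⟨h1, h2⟩

variable [Countable W]

/-- **Φ2 AT `p_c` FOR THE PRODUCT SKELETON**: at every base type `t`, the cylinders of every base type are subcritical at `p_c(X □ Cay(Γ;S), t)`.
[cite: AizenmanGrimmett1991, Thm 1 (essential enhancements)] [cite: BenjaminiSchramm1996, §2 (products)] -/
theorem prod_cylSubcritical (hc : X.Connected) {ΔX : ℕ} (hΔ : ∀ u, X.degree u ≤ ΔX) (V₀ : Finset W)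
    (hV₀ : ∀ v : W, ∃ γ : X ≃g X, γ v ∈ V₀) (t : W × Γ) :
    (D.prodSkeleton X hc hΔ V₀ hV₀).CylSubcritical (criticalProbIOf (X □ mulCayley (S : Set Γ)) t) := by
  haveI : Countable Γ := countable_of_connected_of_locallyFinite _ (D.toCayleyNeg₂.skeleton.graph_connected (1 : Γ)) 1
  rintro ⟨u₀, g₀⟩ ht' ℓ
  obtain ⟨-, ht2⟩ := Finset.mem_product.1 ht'
  rw [Finset.mem_singleton] at ht2
  subst ht2
  -- `p_c` does not depend on the root
  have hconn := (D.prodSkeleton X hc hΔ V₀ hV₀).toPlanarSkeletonNeg.graph_connected t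
  have hpc : criticalProbIOf (X □ mulCayley (S : Set Γ)) t = criticalProbIOf (X □ mulCayley (S : Set Γ)) (u₀, (1 : Γ)) :=
    Subtype.ext (criticalProb_eq_of_reachable _ (hconn.preconnected t _))
  have hlt : criticalProb (X □ mulCayley (S : Set Γ)) (u₀, (1 : Γ)) < 1 :=
    (D.prodSkeleton X hc hΔ V₀ hV₀).toPlanarSkeletonNeg.criticalProb_lt_one _
  have h0 := D.cylData₂.theta_prodCyl_criticalProb_eq_zero X hc hΔ u₀ hlt ℓ
  -- transport through the isomorphism `cylIso`
  have hθ := theta_iso (D.cylIso X ℓ) ⟨(u₀, (1 : Γ)), show D.φ (1 : Γ) - D.φ 1 ∈ box 2 ℓ by rw [sub_self]; exact zero_mem_box 2 ℓ⟩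
    (criticalProbIOf (X □ mulCayley (S : Set Γ)) (u₀, (1 : Γ)))
  rw [hpc]
  change theta ((X □ mulCayley (S : Set Γ)).induce {w : W × Γ | D.φ w.2 - D.φ (1 : Γ) ∈ box 2 ℓ}) ⟨(u₀, (1 : Γ)), _⟩
    (criticalProbIOf (X □ mulCayley (S : Set Γ)) (u₀, (1 : Γ))) = 0
  rw [← hθ]
  exact h0

/-! ## §3 The theorem -/

include D in
/-- **THEOREM (unconditional): `θ_v(p) = 0` for every `p ≤ p_c` at every vertex of `X □ Cay(Γ;S)`**, for every connected, locally finite,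
quasi-transitive graph `X` with a degree bound (Cayley or not) and every `(Γ, S)` carrying a `CayleySign₂` (planar skeleton + two sign
automorphisms + connected unit cylinder); Φ2 for the product is DERIVED by the product strict inequality `p_c(X □ C_{ℓ+2r+1}) < p_c(X □ C_ℓ)`.
builds on p205010 (kernel theorem, internal audit signed; external expert review pending).
[cite: BenjaminiSchramm1996, Conj. 4; §2] [cite: AizenmanGrimmett1991, Thm 1] [cite: KozmaNitzan2024, §1 p. 2 (approach 1)] -/
theorem theta_boxProd_eq_zero_of_le (hc : X.Connected) {ΔX : ℕ} (hΔ : ∀ u, X.degree u ≤ ΔX) (V₀ : Finset W)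
    (hV₀ : ∀ v : W, ∃ γ : X ≃g X, γ v ∈ V₀) (v : W × Γ) {p : unitInterval}
    (hp : (p : ℝ) ≤ criticalProb (X □ mulCayley (S : Set Γ)) v) : theta (X □ mulCayley (S : Set Γ)) v p = 0 := by
  haveI : Countable Γ := countable_of_connected_of_locallyFinite _ (D.toCayleyNeg₂.skeleton.graph_connected (1 : Γ)) 1
  have hpc0 : theta (X □ mulCayley (S : Set Γ)) v (criticalProbIOf (X □ mulCayley (S : Set Γ)) v) = 0 :=
    PlanarSkeletonSign.criticalContinuity' _ (D.prodSkeleton X hc hΔ V₀ hV₀)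
      (fun t _ => D.prod_cylSubcritical X hc hΔ V₀ hV₀ t) v
  have hmono : theta (X □ mulCayley (S : Set Γ)) v p ≤
      theta (X □ mulCayley (S : Set Γ)) v (criticalProbIOf (X □ mulCayley (S : Set Γ)) v) :=
    theta_mono_holds _ _ (Subtype.coe_le_coe.mp hp)
  have hnn : 0 ≤ theta (X □ mulCayley (S : Set Γ)) v p := MeasureTheory.measureReal_nonneg
  linarith

include D in
/-- **`θ_v(p_c) = 0` on `X □ Cay(Γ;S)` for vertex-transitive `X`** (one `X`-type). builds on p205010 (kernel theorem, internal audit signed;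
external expert review pending). [cite: BenjaminiSchramm1996, Conj. 4; §2] -/
theorem criticalContinuity_boxProd_transitive (hc : X.Connected) {ΔX : ℕ} (hΔ : ∀ u, X.degree u ≤ ΔX)
    (hT : ∀ u u' : W, ∃ γ : X ≃g X, γ u = u') (x₀ : W) (v : W × Γ) :
    theta (X □ mulCayley (S : Set Γ)) v (criticalProbIOf (X □ mulCayley (S : Set Γ)) v) = 0 :=
  D.theta_boxProd_eq_zero_of_le X hc hΔ {x₀} (fun u => by
    obtain ⟨γ, hγ⟩ := hT u x₀; exact ⟨γ, by rw [hγ]; exact Finset.mem_singleton_self _⟩) v le_rfl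

end CayleySign₂

end Summit.CriticalPhenomena.PercolationContinuityZ3.Theorems.Transplant

end
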